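import Summits.ABC.ABC.Theses.IsogenyGlueCongruence
import Literature.NumberTheory.EllipticCurves.PastenCongruenceModulusProofs
import Literature.NumberTheory.EllipticCurves.NewformsLevelRaising
import Literature.NumberTheory.EllipticCurves.NewformsMultiplicityOneProofs
import Literature.NumberTheory.DiophantineGeometry.ConductorRadicalProofs
import Literature.NumberTheory.DiophantineGeometry.ConductorFactorizationProofs
import Literature.NumberTheory.DiophantineGeometry.ConductorMultiplicativeProofs
import Literature.NumberTheory.DiophantineGeometry.ConductorExponentZeroProofs
import Literature.NumberTheory.DiophantineGeometry.MinimalDiscriminantProofs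
import HarnessLib

/-!
# Crux A `DegreePrimesPolyBounded` (stmt-ABC-2045), line `Sketch` — stub `stub_oldPartner`
# (reconnaissance + conditional proof)

WORK FILE, not landable as `--supports` (the stub is proved only conditionally; a `--dry-run`
bounces anyway at lint: > 400 lines, contains `def`s). `lean check`: rc 0, 0 sorries.

Outcome: `stub_oldPartner` is TRUE as typed and follows (`stub_oldPartner_of`, § D, fully proved
reduction) from ONE Galois-theoretic statement, `OldLevelCongruencePrime_dvd_factorization` (§ D,
MISSING from the tree), whose literature decomposition (§ E: E1–E5) is typed below with the status
of each piece in the tree. Proved here unconditionally: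

* § A–B: `ℓ ∣ η_f(P) ≠ 0` ⟹ a maximal ideal `𝔪 ∋ ℓ` of `𝕋_N = anemicHeckeRing N 2` with
  `𝕀_f + P ⊆ 𝔪` (Cauchy in the finite ring `𝕋/(𝕀_f + P)`), and the congruence in coefficient
  form (E0): `T_q ≡ a_q(W) (mod 𝔪)`, `T_q (toLevel0 g) = a_q(g) toLevel0 g`, and `𝕋 → 𝕋/𝔪`
  factors through `χ_g` (`congruence_of_le_maximalIdeal`), all `q ∤ N`;
* § C: semistable ⟹ `v_p(N) ≤ 1` (`conductorExponent_eq_{zero,one}_iff_holds`,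
  `factorization_conductorNorm_holds`); `M ∣ N`, `M ≠ N`, `N` squarefree ⟹ a prime `p ∣ N`,
  `p ∤ M`; `p ∣ N` ⟹ `0 < v_p(Δ_min)` (`radical_conductorNorm_eq_holds`).
-/

set_option linter.dupNamespace false

noncomputable section

open scoped MatrixGroups ModularForm
open CongruenceSubgroup
open Literature.NumberTheory.EllipticCurves.ModularForms

namespace Summit.ABC.ABC.Theorems.DegreePrimesPolyBounded

/-! ### A. Commutative algebra: a prime of the congruence modulus is a residue characteristic -/

section CommAlgebra

variable {R : Type*} [CommRing R]

/-- In a finite commutative ring whose order is divisible by the prime `ℓ` there is a maximal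
ideal containing `ℓ` (Cauchy: an element `x` of additive order `ℓ`; its annihilator is a proper
ideal containing `ℓ`). [folklore] -/
theorem exists_isMaximal_natCast_mem_of_prime_dvd_natCard [Finite R] {ℓ : ℕ} (hℓ : ℓ.Prime)
    (hdvd : ℓ ∣ Nat.card R) : ∃ 𝔪 : Ideal R, 𝔪.IsMaximal ∧ (ℓ : R) ∈ 𝔪 := by
  haveI : Fact ℓ.Prime := ⟨hℓ⟩
  obtain ⟨x, hx⟩ := exists_prime_addOrderOf_dvd_card' (G := R) ℓ hdvd
  have hx0 : x ≠ 0 := by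
    rintro rfl
    rw [addOrderOf_zero] at hx
    exact hℓ.one_lt.ne' hx.symm
  have hne : Ideal.torsionOf R R x ≠ ⊤ := by
    intro h
    have h1 : (1 : R) ∈ Ideal.torsionOf R R x := h ▸ Submodule.mem_top
    rw [Ideal.mem_torsionOf_iff, one_smul] at h1
    exact hx0 h1
  obtain ⟨𝔪, h𝔪, hle⟩ := Ideal.exists_le_maximal _ hne
  refine ⟨𝔪, h𝔪, hle ?_⟩
  rw [Ideal.mem_torsionOf_iff, smul_eq_mul, ← nsmul_eq_mul, ← hx]
  exact addOrderOf_nsmul_eq_zero x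

/-- If `R ⧸ (I + J)` is finite of order divisible by the prime `ℓ` (i.e. `ℓ` divides the
congruence modulus `congruenceModulus I J ≠ 0`), there is a maximal ideal `𝔪 ⊇ I + J` of `R`
containing `ℓ`. [folklore] -/
theorem exists_isMaximal_of_prime_dvd_congruenceModulus (I J : Ideal R) {ℓ : ℕ} (hℓ : ℓ.Prime)
    (h0 : congruenceModulus I J ≠ 0) (hdvd : ℓ ∣ congruenceModulus I J) :
    ∃ 𝔪 : Ideal R, 𝔪.IsMaximal ∧ I ≤ 𝔪 ∧ J ≤ 𝔪 ∧ (ℓ : R) ∈ 𝔪 := by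
  haveI : Finite (R ⧸ (I ⊔ J)) := (congruenceModulus_ne_zero_iff I J).mp h0
  obtain ⟨𝔪', h𝔪', hℓ𝔪'⟩ :=
    exists_isMaximal_natCast_mem_of_prime_dvd_natCard (R := R ⧸ (I ⊔ J)) hℓ hdvd
  refine ⟨𝔪'.comap (Ideal.Quotient.mk (I ⊔ J)),
    Ideal.comap_isMaximal_of_surjective _ Ideal.Quotient.mk_surjective, ?_, ?_, ?_⟩
  · exact le_sup_left.trans
      ((Ideal.mk_ker (I := I ⊔ J)).symm.trans_le (Ideal.ker_le_comap _))
  · exact le_sup_right.trans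
      ((Ideal.mk_ker (I := I ⊔ J)).symm.trans_le (Ideal.ker_le_comap _))
  · rw [Ideal.mem_comap, map_natCast]
    exact hℓ𝔪'

/-- A maximal ideal containing the prime `ℓ` has residue characteristic `ℓ`. [folklore] -/
theorem charP_quotient_of_natCast_mem {𝔪 : Ideal R} (h𝔪 : 𝔪.IsMaximal) {ℓ : ℕ} (hℓ : ℓ.Prime)
    (hmem : (ℓ : R) ∈ 𝔪) : CharP (R ⧸ 𝔪) ℓ := by
  haveI : Nontrivial (R ⧸ 𝔪) := Ideal.Quotient.nontrivial_iff.mpr h𝔪.ne_top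
  rw [CharP.charP_iff_prime_eq_zero hℓ, ← map_natCast (Ideal.Quotient.mk 𝔪),
    Ideal.Quotient.eq_zero_iff_mem]
  exact hmem

end CommAlgebra

/-! ### B. The Hecke ring: a congruence prime gives a maximal ideal `𝔪 ∋ ℓ` over `𝕀_f + P` -/

section Hecke

variable {N : ℕ} [NeZero N] {k : ℤ}

/-- **A prime `ℓ` of Pasten's congruence modulus `η_f(P) ≠ 0` is a congruence prime in the Hecke
ring**: there is a maximal ideal `𝔪` of `𝕋 = ℤ[T_p : p ∤ N]` with `𝕀_f + P ⊆ 𝔪` and `ℓ ∈ 𝔪`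
(so `𝕋 ⧸ 𝔪` has characteristic `ℓ`). [folklore] -/
theorem exists_isMaximal_of_prime_dvd_heckeCongruenceModulus (f : CuspForm (Gamma0 N) k)
    (P : Ideal (anemicHeckeRing N k)) {ℓ : ℕ} (hℓ : ℓ.Prime)
    (h0 : heckeCongruenceModulus f P ≠ 0) (hdvd : ℓ ∣ heckeCongruenceModulus f P) :
    ∃ 𝔪 : Ideal (anemicHeckeRing N k), 𝔪.IsMaximal ∧ eigenIdeal f ≤ 𝔪 ∧ P ≤ 𝔪 ∧
      (ℓ : anemicHeckeRing N k) ∈ 𝔪 :=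
  exists_isMaximal_of_prime_dvd_congruenceModulus (eigenIdeal f) P hℓ h0 hdvd

/-- `T_p - a ∈ 𝕀_φ` for a `T_p`-eigenvector `φ` with integer eigenvalue `a` (`p ∤ N`). [folklore] -/
theorem T_sub_intCast_mem_eigenIdeal {φ : CuspForm (Gamma0 N) k} {p : ℕ} [NeZero p]
    (hp : p.Prime) (hpN : ¬ p ∣ N) {a : ℤ} (hc : heckeT (Gamma0 N) k p φ = (a : ℂ) • φ) :
    anemicHeckeRing.T N k p hp hpN - (a : anemicHeckeRing N k) ∈ eigenIdeal φ := by
  rw [mem_eigenIdeal, Subalgebra.coe_sub, LinearMap.sub_apply, anemicHeckeRing.coe_T, hc,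
    SubringClass.coe_intCast, Module.End.intCast_apply, ← Int.cast_smul_eq_zsmul ℂ, ← sub_smul,
    sub_self, zero_smul]

/-- For the newform `f = D.f` of `W` and a prime `p ∤ N`: `T_p f = a_p(W) f` with
`a_p(W) = W.LFunction p ∈ ℤ` (`IsNewformOf`, `IsNewform0.heckeT_eq_coeff_smul`). [folklore] -/
theorem heckeT_f_eq_lFunction_smul {W : WeierstrassCurve ℚ}
    (D : ModularParametrizationData W N) (p : ℕ) [NeZero p] (hp : p.Prime) :
    heckeT (Gamma0 N) 2 p D.f = ((W.LFunction p : ℤ) : ℂ) • D.f := by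
  rw [D.isNewformOf.1.heckeT_eq_coeff_smul hp]
  exact congrArg (· • D.f) (D.isNewformOf.2 p)

/-- Hence `T_p - a_p(W) ∈ 𝕀_f` for every prime `p ∤ N`. [folklore] -/
theorem T_sub_lFunction_mem_eigenIdeal {W : WeierstrassCurve ℚ}
    (D : ModularParametrizationData W N) (p : ℕ) [NeZero p] (hp : p.Prime) (hpN : ¬ p ∣ N) :
    anemicHeckeRing.T N 2 p hp hpN - ((W.LFunction p : ℤ) : anemicHeckeRing N 2) ∈
      eigenIdeal D.f :=
  T_sub_intCast_mem_eigenIdeal hp hpN (heckeT_f_eq_lFunction_smul D p hp)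

omit [NeZero N] in
/-- The level-`N` inclusion of a level-`M` form is the degeneracy map `ι_1` (same function).
[folklore] -/
theorem toLevel0_eq_iota_one {M : ℕ} (hM : M ∣ N) (g : CuspForm (Gamma0 M) k) :
    toLevel0 hM k g = iota M N 1 k (by simpa using hM) g := by
  apply DFunLike.ext'
  funext τ
  rw [coe_toLevel0, coe_iota_apply]
  congr 1
  apply UpperHalfPlane.ext
  simp

/-- **`T_p` on the old form `g` (level `M ∣ N`) at level `N` is `a_p(g)`** for `p ∤ N`:
`T_p (toLevel0 g) = a_p(g) • toLevel0 g` (`heckeT_iota`, `IsNewform0.heckeT_eq_coeff_smul`).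
[folklore] -/
theorem heckeT_toLevel0_eq_coeff_smul' {M : ℕ} [NeZero M] (hM : M ∣ N) {g : CuspForm (Gamma0 M) k}
    (hg : IsNewform0 g) (p : ℕ) [NeZero p] (hp : p.Prime) (hpN : ¬ p ∣ N) :
    heckeT (Gamma0 N) k p (toLevel0 hM k g) =
      (UpperHalfPlane.qExpansion 1 ⇑g).coeff p • toLevel0 hM k g := by
  rw [toLevel0_eq_iota_one hM, heckeT_iota _ hp hpN, hg.heckeT_eq_coeff_smul hp, map_smul]

/-- The old form `toLevel0 g` of a newform `g` is a nonzero simultaneous eigenvector of the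
`T_q`, `q ∤ N`. [folklore] -/
theorem isAnemicEigenvector_toLevel0_and_ne_zero {M : ℕ} [NeZero M] (hM : M ∣ N) {g : CuspForm (Gamma0 M) k}
    (hg : IsNewform0 g) : IsAnemicEigenvector (toLevel0 hM k g) ∧ toLevel0 hM k g ≠ 0 := by
  refine ⟨fun q hq hqN ↦ ?_, fun h ↦ ?_⟩
  · haveI : NeZero q := ⟨hq.ne_zero⟩
    exact ⟨_, heckeT_toLevel0_eq_coeff_smul' hM hg q hq hqN⟩
  · have h1 : (UpperHalfPlane.qExpansion 1 ⇑(toLevel0 hM k g)).coeff 1 = 1 := by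
      rw [qExpansion_toLevel0]; exact hg.2.2
    rw [h, CuspForm.coe_zero, UpperHalfPlane.qExpansion_zero, map_zero] at h1
    exact zero_ne_one h1

/-- **(E0) The congruence in coefficient form.** If a maximal ideal `𝔪` of `𝕋_N` contains the
eigen-ideals of the newform `f = D.f` of `W` and of the old form `toLevel0 g` (`g` a newform of
level `M ∣ N`), then the reduction `𝕋 → 𝕋/𝔪` factors through the eigencharacter `χ_g` of
`toLevel0 g` — a ring homomorphism `ψ : χ_g(𝕋) = ℤ[a_q(g) : q ∤ N] → 𝕋/𝔪` with `ψ(χ_g(t)) = t mod 𝔪`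
— and for every prime `q ∤ N`: `χ_g(T_q) = a_q(g)` and `T_q ≡ a_q(W) (mod 𝔪)`; hence
`ψ(a_q(g)) = a_q(W) mod 𝔪` for all primes `q ∤ N`. [folklore] -/
theorem congruence_of_le_maximalIdeal {W : WeierstrassCurve ℚ} (D : ModularParametrizationData W N)
    {M : ℕ} [NeZero M] (hM : M ∣ N) {g : CuspForm (Gamma0 M) 2} (hg : IsNewform0 g)
    {𝔪 : Ideal (anemicHeckeRing N 2)} (hf𝔪 : eigenIdeal D.f ≤ 𝔪)
    (hg𝔪 : eigenIdeal (toLevel0 hM 2 g) ≤ 𝔪) :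
    ∃ ψ : (eigencharacter (isAnemicEigenvector_toLevel0_and_ne_zero hM hg).1
        (isAnemicEigenvector_toLevel0_and_ne_zero hM hg).2).range →+* anemicHeckeRing N 2 ⧸ 𝔪,
      (∀ t, ψ ((eigencharacter (isAnemicEigenvector_toLevel0_and_ne_zero hM hg).1
        (isAnemicEigenvector_toLevel0_and_ne_zero hM hg).2).rangeRestrict t) = Ideal.Quotient.mk 𝔪 t) ∧
      ∀ (q : ℕ) (hq : q.Prime) (hqN : ¬ q ∣ N),
        (haveI : NeZero q := ⟨hq.ne_zero⟩
         eigencharacter (isAnemicEigenvector_toLevel0_and_ne_zero hM hg).1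
            (isAnemicEigenvector_toLevel0_and_ne_zero hM hg).2 (anemicHeckeRing.T N 2 q hq hqN) =
          (UpperHalfPlane.qExpansion 1 ⇑g).coeff q) ∧
        (haveI : NeZero q := ⟨hq.ne_zero⟩
         Ideal.Quotient.mk 𝔪 (anemicHeckeRing.T N 2 q hq hqN) =
          ((W.LFunction q : ℤ) : anemicHeckeRing N 2 ⧸ 𝔪)) := by
  set χ := eigencharacter (isAnemicEigenvector_toLevel0_and_ne_zero hM hg).1
    (isAnemicEigenvector_toLevel0_and_ne_zero hM hg).2 with hχ
  have hsurj : Function.Surjective χ.rangeRestrict := RingHom.rangeRestrict_surjective χ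
  have hker : RingHom.ker χ.rangeRestrict ≤ RingHom.ker (Ideal.Quotient.mk 𝔪) := by
    rw [RingHom.ker_rangeRestrict, Ideal.mk_ker, hχ, ← eigenIdeal_eq_ker_eigencharacter]
    exact hg𝔪
  refine ⟨χ.rangeRestrict.liftOfRightInverse (Function.surjInv hsurj)
      (Function.rightInverse_surjInv hsurj) ⟨Ideal.Quotient.mk 𝔪, hker⟩, fun t ↦ ?_,
    fun q hq hqN ↦ ⟨?_, ?_⟩⟩
  · exact RingHom.liftOfRightInverse_comp_apply _ _ _ _ t
  · haveI : NeZero q := ⟨hq.ne_zero⟩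
    exact eigencharacter_eq_of_apply_eq_smul _ _
      (by rw [anemicHeckeRing.coe_T]; exact heckeT_toLevel0_eq_coeff_smul' hM hg q hq hqN)
  · haveI : NeZero q := ⟨hq.ne_zero⟩
    have h := hf𝔪 (T_sub_lFunction_mem_eigenIdeal D q hq hqN)
    rw [← Ideal.Quotient.eq_zero_iff_mem, map_sub, sub_eq_zero, map_intCast] at h
    exact h

end Hecke

/-! ### C. Arithmetic of the conductor and the minimal discriminant of a semistable curve -/

section Arithmetic

open IsDedekindDomain

variable (W : WeierstrassCurve ℚ) [W.IsElliptic]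

/-- `v_p(N_E) = f_{v_p}` at the place above `p`. [folklore] -/
theorem factorization_conductorNorm_eq_conductorExponent (p : Nat.Primes) :
    (W.conductorNorm ℤ).factorization p =
      W.conductorExponent ((Rat.HeightOneSpectrum.primesEquiv (R := ℤ)).symm p) := by
  have hgen : Rat.HeightOneSpectrum.natGenerator
      ((Rat.HeightOneSpectrum.primesEquiv (R := ℤ)).symm p) = p :=
    congrArg Subtype.val ((Rat.HeightOneSpectrum.primesEquiv (R := ℤ)).apply_symm_apply p)
  have h := WeierstrassCurve.factorization_conductorNorm_holds W
    ((Rat.HeightOneSpectrum.primesEquiv (R := ℤ)).symm p)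
  rwa [hgen] at h

/-- **A semistable curve has squarefree conductor**: `v_p(N_E) ≤ 1` for every `p`
(`f_v = 0` at good, `= 1` at multiplicative places; Silverman ATAEC IV.10.2, the tree's
`conductorExponent_eq_zero_iff_holds`, `conductorExponent_eq_one_iff_holds`). [folklore] -/
theorem factorization_conductorNorm_le_one (hW : W.IsSemistable ℤ) (p : ℕ) :
    (W.conductorNorm ℤ).factorization p ≤ 1 := by
  by_cases hp : p.Prime
  · rw [factorization_conductorNorm_eq_conductorExponent W ⟨p, hp⟩]
    set v := (Rat.HeightOneSpectrum.primesEquiv (R := ℤ)).symm ⟨p, hp⟩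
    have h0 : W.conductorExponent v = 0 ↔ W.HasGoodReductionAt v :=
      WeierstrassCurve.conductorExponent_eq_zero_iff_holds v W
    have h1 : W.conductorExponent v = 1 ↔ W.HasMultiplicativeReductionAt v :=
      WeierstrassCurve.conductorExponent_eq_one_iff_holds v W
    have hv : W.IsSemistableAt v := hW v
    rw [WeierstrassCurve.IsSemistableAt, ← h0, ← h1] at hv
    omega
  · exact (Nat.factorization_eq_zero_of_not_prime _ hp).trans_le (Nat.zero_le _)

/-- **A bad prime divides the minimal discriminant**: if `p ∣ N_E` then `v_p(Δ_min) > 0`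
(`N_E` and `|Δ_min|` have the same radical, `radical_conductorNorm_eq_holds`). [folklore] -/
theorem factorization_minimalDiscriminantNorm_pos {p : ℕ} (hp : p.Prime)
    (hpN : p ∣ W.conductorNorm ℤ) : 0 < (W.minimalDiscriminantNorm ℤ).factorization p := by
  have hN0 : W.conductorNorm ℤ ≠ 0 := (WeierstrassCurve.conductorNorm_pos_holds W).ne'
  have hΔ0 : W.minimalDiscriminantNorm ℤ ≠ 0 :=
    (WeierstrassCurve.minimalDiscriminantNorm_pos_holds W).ne'
  have hrad := WeierstrassCurve.radical_conductorNorm_eq_holds W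
  have hmem : p ∈ (W.conductorNorm ℤ).primeFactors := Nat.mem_primeFactors.mpr ⟨hp, hpN, hN0⟩
  rw [← Nat.primeFactors_radical, hrad, Nat.primeFactors_radical] at hmem
  exact hp.factorization_pos_of_dvd hΔ0 (Nat.dvd_of_mem_primeFactors hmem)

omit [W.IsElliptic] in
variable {W} in
/-- A proper divisor `M` of a squarefree `N` misses a prime of `N`. [folklore] -/
theorem exists_prime_dvd_not_dvd_of_squarefree {M N : ℕ} (hN0 : N ≠ 0)
    (hN : ∀ p, N.factorization p ≤ 1) (hM : M ∣ N) (hMN : M ≠ N) :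
    ∃ p : ℕ, p.Prime ∧ p ∣ N ∧ ¬ p ∣ M := by
  by_contra h
  push Not at h
  have hM0 : M ≠ 0 := fun hM0 ↦ hN0 (zero_dvd_iff.mp (hM0 ▸ hM))
  apply hMN
  refine Nat.dvd_antisymm hM ((Nat.factorization_le_iff_dvd hN0 hM0).mp fun p ↦ ?_)
  by_cases hp : p.Prime
  · by_cases hpN : p ∣ N
    · exact (hN p).trans (hp.factorization_pos_of_dvd hM0 (h p hp hpN))
    · rw [Nat.factorization_eq_zero_of_not_dvd hpN]
      exact Nat.zero_le _
  · rw [Nat.factorization_eq_zero_of_not_prime _ hp]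
    exact Nat.zero_le _

end Arithmetic

/-! ### D. The conditional stub: the Galois-theoretic input as an explicit hypothesis -/

section Galois

/-- **Stub `stub_oldPartner_of` (registered, PROVED): old-partner peeling modulo the Galois input.**
The hypothesis `hGal` is the statement "old-level congruence primes divide a Tamagawa exponent"
(in substance Eichler–Shimura–Igusa–Carayol mod-`λ` representations + Chebotarev–Brauer–Nesbitt +
Mazur 1978 irreducibility for semistable curves and `ℓ ≥ 11` + the Tate curve; Ribet 1990 §§1–2,
Darmon–Diamond–Taylor 1995 Prop. 2.12(c)), phrased in the Hecke-ring vocabulary: if the newform `f`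
of a semistable globally minimal `W` of conductor `N` and the level-`N` lift of a newform `g` of level
`M ∣ N` have eigen-ideals inside a common maximal ideal `𝔪 ∋ ℓ` of `𝕋_N`, `ℓ ≥ 11`, `ℓ ∤ N`, and
`p ∣ N`, `p ∤ M`, then `ℓ ∣ v_p(Δ_min(W))`.  Everything else — from `ℓ ∣ η_f(𝕀_g) ≠ 0` to such an
`𝔪` (§§ A–B), squarefreeness of the conductor of a semistable curve, a prime `p ∣ N`, `p ∤ M` for a
proper divisor `M`, and `v_p(Δ_min) > 0` for `p ∣ N` (§ C) — is proved here. [folklore] -/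
theorem stub_oldPartner_of
    (hGal : ∀ (N : ℕ) [NeZero N] (W : WeierstrassCurve ℚ) [W.IsElliptic] [W.IsGloballyMinimal],
          W.IsSemistable ℤ → W.conductorNorm ℤ = N →
          ∀ (f : CuspForm (Gamma0 N) 2), IsNewformOf W f →
          ∀ (M : ℕ) [NeZero M] (hM : M ∣ N) (g : CuspForm (Gamma0 M) 2), IsNewform0 g →
          ∀ (p ℓ : ℕ), p.Prime → ℓ.Prime → p ∣ N → ¬ p ∣ M → ¬ ℓ ∣ N → 11 ≤ ℓ →
          ∀ 𝔪 : Ideal (anemicHeckeRing N 2), 𝔪.IsMaximal → (ℓ : anemicHeckeRing N 2) ∈ 𝔪 →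
            eigenIdeal f ≤ 𝔪 → eigenIdeal (toLevel0 hM 2 g) ≤ 𝔪 →
            ℓ ∣ (W.minimalDiscriminantNorm ℤ).factorization p) :
    ∀ (N : ℕ) [NeZero N] (W : WeierstrassCurve ℚ) [W.IsElliptic] [W.IsGloballyMinimal],
      W.IsSemistable ℤ → W.conductorNorm ℤ = N →
      ∀ (D : ModularParametrizationData W N) (M : ℕ) [NeZero M] (hM : M ∣ N), M ≠ N →
      ∀ g : CuspForm (Gamma0 M) 2, IsNewform0 g →
      ∀ ℓ : ℕ, ℓ.Prime →
        heckeCongruenceModulus D.f (eigenIdeal (toLevel0 hM 2 g)) ≠ 0 →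
        ℓ ∣ heckeCongruenceModulus D.f (eigenIdeal (toLevel0 hM 2 g)) →
        (∃ p : ℕ, p.Prime ∧ p ∣ N ∧ 0 < (W.minimalDiscriminantNorm ℤ).factorization p ∧
            ℓ ∣ (W.minimalDiscriminantNorm ℤ).factorization p) ∨ ℓ ∣ N ∨ ℓ < 11 := by
  intro N _ W _ _ hW hN D M _ hM hMN g hg ℓ hℓ h0 hdvd
  by_cases hℓN : ℓ ∣ N
  · exact Or.inr (Or.inl hℓN)
  by_cases hℓ11 : ℓ < 11
  · exact Or.inr (Or.inr hℓ11)
  left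
  obtain ⟨𝔪, h𝔪, hf𝔪, hg𝔪, hℓ𝔪⟩ :=
    exists_isMaximal_of_prime_dvd_heckeCongruenceModulus D.f _ hℓ h0 hdvd
  have hN0 : N ≠ 0 := NeZero.ne N
  have hsq : ∀ p, N.factorization p ≤ 1 := fun p ↦ by
    rw [← hN]; exact factorization_conductorNorm_le_one W hW p
  obtain ⟨p, hp, hpN, hpM⟩ := exists_prime_dvd_not_dvd_of_squarefree hN0 hsq hM hMN
  refine ⟨p, hp, hpN, factorization_minimalDiscriminantNorm_pos W hp (by rw [hN]; exact hpN), ?_⟩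
  exact hGal N W hW hN D.f D.isNewformOf M hM g hg p ℓ hp hℓ hpN hpM hℓN (not_lt.mp hℓ11) 𝔪 h𝔪
    hℓ𝔪 hf𝔪 hg𝔪

end Galois

end Summit.ABC.ABC.Theorems.DegreePrimesPolyBounded

end
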